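import Summits.CriticalPhenomena.Ising3DConformalLimit.Theorems.IsingEuclidUpgradeR4NonGaussianDefs
import Summits.CriticalPhenomena.Ising3DConformalLimit.Theorems.PerfectScreeningGaussianLimitNotScreenedDefs
import Summits.CriticalPhenomena.Ising3DConformalLimit.Theses.PerfectScreening
import HarnessLib

/-!
# Ideator 4 (round 2) — typed statements for the memo `Ideator4Round2.md`
(crux stmt-CriticalPhenomena-13885 `CoulombImpliesNontrivial`)

Nothing here is a line or a stub. Two statements are typed so that a future seat can land / attack them:

* `FatHitsCrossingSet` — **provable now** (exact one-point density + ADC21 Prop. A.3 two-step bound +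
  Paley–Zygmund, with the shell-point selection `|‖uᵢ−m‖ − ‖uⱼ−m‖| ≤ ‖uᵢ−uⱼ‖`): under the Coulomb
  antecedent the FAT cluster `C_{n₁+n₂}(x)` of `P^{xy,∅}_{Λ_L}` meets EVERY set that crosses the shells
  `∂B(m,k)`, `R/8 ≤ k ≤ R/4`, with probability `≥ c'/log R` — the `2 + 1 = 3` marginality of
  (dimension-2 fat cluster) × (any crossing curve) in `d = 3`; path-geometry free.
* `PolylogMerge` — the SQUEEZE target (NOT claimed provable; see memo §2): under Coulomb the thin merging
  probability `P²` at the axial quadruple decays at most polylogarithmically. It does NOT imply the crux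
  (the pointwise renormalisation `ρ(δ)⁴ ≍ δ⁻²` eats polylogs) but it is inconsistent with every
  POLYNOMIAL Gaussian counterfactual (thin dimension `D < 3/2`), leaving only the log-marginal one.
-/

noncomputable section

namespace Summit.CriticalPhenomena.Ising3DConformalLimit.Cruxes.CoulombImpliesNontrivial.Ideator4

open Literature.Probability.LatticeModels Filter MeasureTheory Finset
open Summit.CriticalPhenomena.Ising3DConformalLimit.Cruxes.IsingEuclidUpgradeR4NonGaussian.FreeCovarianceDeltaDichotomy
  (twoCurrentMeet)
open Summit.CriticalPhenomena.Ising3DConformalLimit.Cruxes.GaussianLimitNotScreened.KaramataAmplitudeBlindMerging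
  (traceCluster)
open scoped symmDiff

/-- The crux's antecedent (verbatim `Disproof.Coulomb`). -/
def Coulomb : Prop :=
  ∃ c : ℝ, 0 < c ∧ ∀ x : Site 3, x ≠ 0 → c / ‖x‖ ≤ criticalTwoPoint 3 x

/-- `S` meets every sup-norm shell of integer radius `k ∈ [R/8, R/4]` about `m` ("`S` crosses the middle
annulus" — e.g. the vertex set of any path entering `B(m,R/8)` from outside `B(m,R/4)`). -/
def CrossesShells (R : ℕ) (m : Site 3) (S : Finset (Site 3)) : Prop :=
  ∀ k : ℕ, R / 8 ≤ k → k ≤ R / 4 → ∃ u ∈ S, ‖u - m‖ = (k : ℝ)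

/-- **FAT HITS ANY CROSSING SET (log form).** Under Coulomb there are `c' > 0`, `R₀` such that for every
scale `R ≥ R₀`, every `x, y, m` with `‖x−m‖, ‖y−m‖ ∈ [R, 2R]` and `‖x−y‖ ≥ R`, and every finite set `S`
crossing the shells about `m`, eventually in `L` the fat cluster of `x` under `P^{xy,∅}_{Λ_L,β_c}` meets
`S` with probability at least `c'/log R`. Proof sketch (memo §2.1): pick `u_k ∈ S ∩ ∂B(m,k)`,
`N := #{k : u_k ∈ C(x)}`; `E N = Σ_k G(x,u_k)G(u_k,y)/G(x,y) ≥ c₁` (exact density, two-sided Coulomb);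
`E N² ≤ Σ_{k,l} twoStep/G(x,y) ≤ C Σ_{k,l} (1 + |k−l|)⁻¹ ≤ C' log R` (Prop. A.3 + infrared bound +
`‖u_k − u_l‖ ≥ |k − l|`); Paley–Zygmund. -/
def FatHitsCrossingSet : Prop :=
  Coulomb → ∃ c' : ℝ, 0 < c' ∧ ∃ R₀ : ℕ, ∀ R : ℕ, R₀ ≤ R → ∀ x y m : Site 3,
    (R : ℝ) ≤ ‖x - m‖ → ‖x - m‖ ≤ 2 * R → (R : ℝ) ≤ ‖y - m‖ → ‖y - m‖ ≤ 2 * R →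
    (R : ℝ) ≤ ‖x - y‖ →
    ∀ S : Finset (Site 3), CrossesShells R m S →
      ∀ᶠ L : ℕ in atTop,
        c' / Real.log R ≤
          (sourcedDoubleCurrentLaw 3 L (criticalBeta 3) ({x} ∆ {y}) ∅).real
            {ω | ∃ u ∈ S, u ∈ traceCluster L ω x}

/-- The axial point `k·R·e₀`. -/
def axisPt (R k : ℕ) : Site 3 := Pi.single 0 ((k * R : ℕ) : ℤ)

/-- **POLYLOG MERGE (the squeeze target, memo §2; not claimed provable).** Under Coulomb the thin
merging probability `P² = P^{{0}∆{Re₀},{2Re₀}∆{3Re₀}}_{Λ_L}[0 ↔ 2Re₀]` decays at most polylogarithmically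
in `R` (eventually in `L`). Equivalent, through the box identity `U₄ = −2GG·P²`, to
`|U₄^{lat}| ≥ c·GG/(log R)^a`, hence to `g_L ≥ c/(log L)^a`; strictly WEAKER than `MergingFloor`
(item 15592) and it does not give `HasNontrivialU4` of a pointwise limit. -/
def PolylogMerge : Prop :=
  Coulomb → ∃ a c : ℝ, 0 < c ∧ ∃ R₀ : ℕ, ∀ R : ℕ, R₀ ≤ R →
    ∀ᶠ L : ℕ in atTop,
      c / Real.log R ^ a ≤ twoCurrentMeet L (axisPt R 0) (axisPt R 1) (axisPt R 2) (axisPt R 3)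

/-- Sanity: `PolylogMerge` with `a = 0` is exactly a uniform merging floor at the axial quadruple. -/
example (h : Coulomb → ∃ c : ℝ, 0 < c ∧ ∃ R₀ : ℕ, ∀ R : ℕ, R₀ ≤ R → ∀ᶠ L : ℕ in atTop,
      c ≤ twoCurrentMeet L (axisPt R 0) (axisPt R 1) (axisPt R 2) (axisPt R 3)) : PolylogMerge := by
  intro hC
  obtain ⟨c, hc, R₀, hR⟩ := h hC
  refine ⟨0, c, hc, R₀, fun R hR₀ => ?_⟩
  filter_upwards [hR R hR₀] with L hL
  simpa using hL

end Summit.CriticalPhenomena.Ising3DConformalLimit.Cruxes.CoulombImpliesNontrivial.Ideator4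

end
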